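import Summits.QuantumFields.BalabanUV.Beta.GAN24.DerivativeRateTransferJensenMeanZero

/-!
# `BalabanUV.Beta.GAN24.DerivativeRateTransferJensenMeanZeroTree` — binder row G-an2-4 ∕ (CONV-C), route R6 «VALUES, NOT DERIVATIVES», PART 49:
# THE BLOCK POINCARÉ DATUM FROM ROOTED TREE TRANSPORTS — PART 47's hypotheses `hP` ∕ `hΦ` (block variance of the root-frame field `≤ Φ`,
# `w_c·Σ_{e′}Φ(tgt′e′) ≤ ϖ·⟨u,H_f u⟩`) DISCHARGED when the block transporters are products of the fine bond transporters along a rooted tree of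
# fine bonds (Bałaban's contours `Γ_{y,x}`): `ϖ·w_f ≥ 4·w_c·d′·m_T`, `m_T` = the `q·depth`-weighted multiplicity of the tree paths through a fine bond
# (unit b2b-balaban-gan24-p3, gen 42; v1)

NOT IN PRINT; OUR PROOF (for the ROUTE; [folklore] finite-dimensional linear algebra over `ℝ` — PART 21's chain letters (`dotProduct_self_chain_le`,
`orthogonal_partialTransport`), PART 22's counting pattern, PART 47's END BY NAME).  HONEST FRAMING (cell contract, verbatim): «discharging `BetaPertH`
makes Bałaban's UV stability UNCONDITIONAL — a real constructive-QFT result; it is NOT the continuum limit and NOT the Clay problem.»  HONEST DEPENDENCY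
(verbatim): «continuum YM on T⁴ ⇐ BetaPertH ∧ nine spine estimates (0/9 proved); BetaPertH ⇐ (D1) ∧ (D4) ∧ CAP+tail; G-an2-4 gates asym, D1 and NE2/3/4.»

WHY THIS FILE.  PART 47 (`DerivativeRateTransferJensenMeanZero.covJensen_meanZero`) carries two hypotheses about the block transporters `W(y,x)` beyond
orthogonality: a block POINCARÉ datum `Σ_x q(y,x)|W(y,x)u(x) − (Qu)(y)|² ≤ Φ(y)` and its bookkeeping `w_c·Σ_{e′}Φ(tgt′e′) ≤ ϖ·⟨u, H_f u⟩`.  In Bałaban's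
averaging ([CMP 95 (1.6)–(1.7)], [CMP 98 (10)], [CMP 99 (3.19)]) `W(y,x) = U(Γ_{y,x})` is the transport along a CONTOUR from the block root to `x` — the
taxi path, i.e. a rooted spanning TREE of fine bonds in each block.  THIS FILE proves the datum for that structure, abstractly: if for every block `y`
and site `x` there is a chain of `dep(y,x)` fine bonds `pγ(y,x,i)` through sites `pxs(y,x,0) = root(y), …, pxs(y,x,dep) = x` with partial transports
`pT(y,x,i)` and `W(y,x) = W(y,root y)·pT(y,x,dep(y,x))`, then (block weights `q ≥ 0` with `Σ_x q(y,x) = 1` EXACTLY — the mean is a mean)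
  `Σ_x q(y,x)|W(y,x)u(x) − (Qu)(y)|² ≤ 4·Σ_x q(y,x)·dep(y,x)·Σ_{i<dep(y,x)} |D_{pγ(y,x,i)}u|²`     (§2 `blockVar_le_tree`: variance ≤ 4 × second moment about
the root value (Jensen), each root-to-site difference a transported chain of fine covariant differences (PART 21's chain bound)), and with the
`q·dep`-weighted tree multiplicity `Σ_y Σ_x Σ_{i<dep} [pγ(y,x,i) = e]·q(y,x)·dep(y,x) ≤ m_T` of every fine bond `e`, in-degree `≤ d′` and the bookkeeping
`4·w_c·d′·m_T ≤ ϖ·w_f`:  `w_c·Σ_{e′}Φ(tgt′e′) ≤ ϖ·⟨u,H_f u⟩` (§2 `sum_blockVar_le_tree`).  Lattice values (side `L`, dimension `d`, `q = L^{−d}`, taxi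
trees: `dep ≤ d(L−1)`, a bond lies on at most `L^{d−1}(L−1)` root paths of its own block): `m_T ≤ d(L−1)²∕L`, so `ϖ = 4d′d(L−1)²∕L·(w_c∕w_f)` — an
`L`-dependent constant, harmless at fixed `L` (the instantiation on PART 24's lattice encoding is NOT done here).  §3 **`covJensen_meanZero_tree`**
= PART 47's END with `hP` ∕ `hΦ` DISCHARGED: the only letters left about the pair (averaging, coarse connection) are the pointwise and mean root-frame
holonomy defects `κ`, `κ₂`.

WHAT THIS FILE PROVES (0 sorry, 0 `def`, nothing cited):
* §1 `wvar_le_four_wmoment` (weights `q ≥ 0`, `Σq = 1`: `Σ_x q_x|v_x − Σ q v|² ≤ 4·Σ_x q_x|v_x − c|²` for any `c`), `sum_tree_le_of_multiplicity`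
  (the counting sum with variable path lengths and weights `q·dep`).
* §2 **`blockVar_le_tree`**, **`sum_blockVar_le_tree`**.
* §3 **`covJensen_meanZero_tree`** (`⟨Qu,H_cQu⟩ ≤ (1 + t + (1+t⁻¹)(1+r)ϖκ²)⟨u,H_fu⟩ + (1+t⁻¹)(1+r⁻¹)κ₂²w_c d′⟨Qu,Qu⟩` from tree data, `κ`, `κ₂`).
WHAT IT DOES NOT DO: instantiate the tree data on PART 24's lattice encoding (taxi contours in `(Fin d → ZMod M) × (Fin d → Fin L)`), bound `κ` ∕ `κ₂`
for any of Bałaban's fields, or claim anything about (CONS) ∕ exact (STAB).  SUPPLIER work on route R6 (rank 2, REDUCTION, no seat); no consumer of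
record; NEVER «G-an2-4 closed»; NOT (CONV-C), NOT D1, NOT `BetaPertH`, NOT continuum, NOT Clay.  Records: `HOME/b2b-balaban-gan24-p3/WOODBURY-FIBRE.md` v14.2. -/

noncomputable section

open Matrix Finset

namespace Summit.QuantumFields.BalabanUV.Beta.GAN24.DerivativeRateTransferJensenMeanZeroTree

open Summit.QuantumFields.BalabanUV.Beta.GAN24.DerivativeRateTransferLoewnerKKT (mulVec_dotProduct_eq)
open Summit.QuantumFields.BalabanUV.Beta.GAN24.DerivativeRateTransferJensenChain
open Summit.QuantumFields.BalabanUV.Beta.GAN24.DerivativeRateTransferJensen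
open Summit.QuantumFields.BalabanUV.Beta.GAN24.DerivativeRateTransferJensenMeanZero

/-! ## §1 Tools: variance against any centre; the tree counting sum -/

section Tools

variable {o : Type*} [Fintype o]

/-- **VARIANCE ≤ 4 × SECOND MOMENT ABOUT ANY CENTRE**: weights `q ≥ 0` with `Σ_x q_x = 1`, vectors `v_x`, any `c`:
`Σ_x q_x|v_x − Σ_{x′} q_{x′}v_{x′}|² ≤ 4·Σ_x q_x|v_x − c|²` (Peter–Paul at `t = 1` and Jensen; the sharp constant is `1`). [folklore] -/
theorem wvar_le_four_wmoment {ν : Type*} (s : Finset ν) {q : ν → ℝ} (hq : ∀ x ∈ s, 0 ≤ q x) (hq1 : ∑ x ∈ s, q x = 1)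
    (v : ν → o → ℝ) (c : o → ℝ) :
    ∑ x ∈ s, q x * ((v x - ∑ x' ∈ s, q x' • v x') ⬝ᵥ (v x - ∑ x' ∈ s, q x' • v x')) ≤
      4 * ∑ x ∈ s, q x * ((v x - c) ⬝ᵥ (v x - c)) := by
  set vbar : o → ℝ := ∑ x' ∈ s, q x' • v x' with hvbar
  have hmean : vbar - c = ∑ x ∈ s, q x • (v x - c) := by
    simp only [hvbar, smul_sub, Finset.sum_sub_distrib, ← Finset.sum_smul, hq1, one_smul]
  have hJ : (vbar - c) ⬝ᵥ (vbar - c) ≤ ∑ x ∈ s, q x * ((v x - c) ⬝ᵥ (v x - c)) := by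
    rw [hmean]; exact dotProduct_self_wsum_le' s hq hq1.le _
  have hx : ∀ x ∈ s, q x * ((v x - vbar) ⬝ᵥ (v x - vbar)) ≤
      q x * (2 * ((v x - c) ⬝ᵥ (v x - c)) + 2 * ((vbar - c) ⬝ᵥ (vbar - c))) := fun x hx => by
    refine mul_le_mul_of_nonneg_left ?_ (hq x hx)
    have e : v x - vbar = (v x - c) + (c - vbar) := by abel
    have h := dotProduct_self_add_le (v x - c) (c - vbar) one_pos
    have e2 : (c - vbar) ⬝ᵥ (c - vbar) = (vbar - c) ⬝ᵥ (vbar - c) := by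
      rw [show c - vbar = -(vbar - c) by abel, neg_dotProduct, dotProduct_neg, neg_neg]
    rw [e]; rw [inv_one, e2] at h; linarith
  calc ∑ x ∈ s, q x * ((v x - vbar) ⬝ᵥ (v x - vbar))
      ≤ ∑ x ∈ s, q x * (2 * ((v x - c) ⬝ᵥ (v x - c)) + 2 * ((vbar - c) ⬝ᵥ (vbar - c))) := Finset.sum_le_sum hx
    _ = 2 * ∑ x ∈ s, q x * ((v x - c) ⬝ᵥ (v x - c)) + 2 * ((∑ x ∈ s, q x) * ((vbar - c) ⬝ᵥ (vbar - c))) := by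
        rw [Finset.mul_sum, Finset.sum_mul, Finset.mul_sum, ← Finset.sum_add_distrib]
        exact Finset.sum_congr rfl fun x _ => by ring
    _ ≤ 4 * ∑ x ∈ s, q x * ((v x - c) ⬝ᵥ (v x - c)) := by rw [hq1, one_mul]; linarith

/-- **THE TREE COUNTING SUM**: if the `q·dep`-weighted multiplicity of the root paths through every fine bond `e` is
`Σ_y Σ_x Σ_{i<dep(y,x)} [pγ(y,x,i) = e]·q(y,x)·dep(y,x) ≤ m_T`, then `Σ_y Σ_x q(y,x)·dep(y,x)·Σ_{i<dep(y,x)} F(pγ(y,x,i)) ≤ m_T·Σ_e F(e)` for `F ≥ 0`.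
[folklore] -/
theorem sum_tree_le_of_multiplicity {β μ ν : Type*} [Fintype β] [DecidableEq β] [Fintype μ] [Fintype ν]
    (q : μ → ν → ℝ) (dep : μ → ν → ℕ) (pγ : μ → ν → ℕ → β) {mT : ℝ}
    (hmult : ∀ e, ∑ y, ∑ x, ∑ i ∈ range (dep y x), (if pγ y x i = e then q y x * dep y x else 0) ≤ mT)
    (F : β → ℝ) (hF : ∀ e, 0 ≤ F e) :
    ∑ y, ∑ x, q y x * (dep y x * ∑ i ∈ range (dep y x), F (pγ y x i)) ≤ mT * ∑ e, F e := by
  have h1 : ∀ y x, q y x * (dep y x * ∑ i ∈ range (dep y x), F (pγ y x i)) =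
      ∑ e, (∑ i ∈ range (dep y x), (if pγ y x i = e then q y x * dep y x else 0)) * F e := by
    intro y x
    rw [← mul_assoc, Finset.mul_sum]
    simp_rw [Finset.sum_mul]
    rw [Finset.sum_comm]
    refine Finset.sum_congr rfl fun i _ => ?_
    simp_rw [ite_mul, zero_mul]
    rw [Finset.sum_ite_eq]
    simp
  have h2 : ∀ y, ∑ x, ∑ e, (∑ i ∈ range (dep y x), (if pγ y x i = e then q y x * dep y x else 0)) * F e =
      ∑ e, ∑ x, (∑ i ∈ range (dep y x), (if pγ y x i = e then q y x * dep y x else 0)) * F e := fun y => Finset.sum_comm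
  simp_rw [h1, h2]
  rw [Finset.sum_comm, Finset.mul_sum]
  refine Finset.sum_le_sum fun e _ => ?_
  simp_rw [← Finset.sum_mul]
  exact mul_le_mul_of_nonneg_right (hmult e) (hF e)

end Tools

/-! ## §2 The block Poincaré datum from rooted tree transports -/

section Tree

variable {o μ ν β β' : Type*} [Fintype o] [DecidableEq o] [Fintype μ] [DecidableEq μ] [Fintype ν] [Fintype β] [DecidableEq β] [Fintype β']
variable {q : μ → ν → ℝ} {W : μ → ν → Matrix o o ℝ} {Q : Matrix (μ × o) (ν × o) ℝ}
variable {src tgt : β → ν} {R : β → Matrix o o ℝ} {tgt' : β' → μ}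
variable {Hf : Matrix (ν × o) (ν × o) ℝ} {wf wc : ℝ}
variable {root : μ → ν} {dep : μ → ν → ℕ} {pxs : μ → ν → ℕ → ν} {pγ : μ → ν → ℕ → β} {pT : μ → ν → ℕ → Matrix o o ℝ}
variable {mT ϖ d' : ℝ}

omit [Fintype μ] [DecidableEq μ] [Fintype β] [DecidableEq β] [Fintype β'] in
/-- **`blockVar_le_tree` — PART 47's `hP` FROM TREE TRANSPORTS** [our proof]: block weights `q ≥ 0` with `Σ_x q(y,x) = 1`, the averaging identity
`(Qu)(y) = Σ_x q(y,x)W(y,x)u(x)`, orthogonal `W(y,root y)` and fine transporters `R`, root paths `pxs ∕ pγ ∕ pT` of length `dep(y,x)` with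
`W(y,x) = W(y,root y)·pT(y,x,dep(y,x))` ⟹ `Σ_x q(y,x)|W(y,x)u(x) − (Qu)(y)|² ≤ 4·Σ_x q(y,x)·dep(y,x)·Σ_{i<dep(y,x)}|D_{pγ(y,x,i)}u|²`. -/
theorem blockVar_le_tree
    (hq : ∀ y x, 0 ≤ q y x) (hq1 : ∀ y, ∑ x, q y x = 1) (hW0 : ∀ y, (W y (root y))ᵀ * W y (root y) = 1) (hR : ∀ e, (R e)ᵀ * R e = 1)
    (hQ : ∀ (u : ν × o → ℝ) (y : μ), (fun a => (Q *ᵥ u) (y, a)) = ∑ x, q y x • (W y x *ᵥ fun b => u (x, b)))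
    (hp0 : ∀ y x, pxs y x 0 = root y) (hpend : ∀ y x, pxs y x (dep y x) = x)
    (hpsrc : ∀ y x i, i < dep y x → src (pγ y x i) = pxs y x i) (hptgt : ∀ y x i, i < dep y x → tgt (pγ y x i) = pxs y x (i + 1))
    (hpT0 : ∀ y x, pT y x 0 = 1) (hpT : ∀ y x i, i < dep y x → pT y x (i + 1) = pT y x i * R (pγ y x i))
    (hWtree : ∀ y x, W y x = W y (root y) * pT y x (dep y x)) (u : ν × o → ℝ) (y : μ) :
    ∑ x, q y x * (((W y x *ᵥ fun b => u (x, b)) - fun a => (Q *ᵥ u) (y, a)) ⬝ᵥ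
        ((W y x *ᵥ fun b => u (x, b)) - fun a => (Q *ᵥ u) (y, a))) ≤
      4 * ∑ x, q y x * (dep y x * ∑ i ∈ range (dep y x),
        ((R (pγ y x i) *ᵥ fun b => u (tgt (pγ y x i), b)) - fun b => u (src (pγ y x i), b)) ⬝ᵥ
          ((R (pγ y x i) *ᵥ fun b => u (tgt (pγ y x i), b)) - fun b => u (src (pγ y x i), b))) := by
  rw [hQ u y]
  refine (wvar_le_four_wmoment Finset.univ (fun x _ => hq y x) (hq1 y) (fun x => W y x *ᵥ fun b => u (x, b))
    (W y (root y) *ᵥ fun b => u (root y, b))).trans ?_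
  rw [Finset.mul_sum, Finset.mul_sum]
  refine Finset.sum_le_sum fun x _ => ?_
  refine mul_le_mul_of_nonneg_left (mul_le_mul_of_nonneg_left ?_ (hq y x)) (by norm_num)
  -- the root-to-site difference is a transported chain
  have e : (W y x *ᵥ fun b => u (x, b)) - (W y (root y) *ᵥ fun b => u (root y, b)) =
      W y (root y) *ᵥ ((pT y x (dep y x) *ᵥ fun b => u (x, b)) - fun b => u (root y, b)) := by
    rw [hWtree y x, mulVec_sub, mulVec_mulVec]
  rw [e, self_of_orthogonal (hW0 y)]
  have h := dotProduct_self_chain_le (R := fun i => R (pγ y x i)) (T := pT y x) (ℓ := dep y x) (fun i _ => hR _) (hpT0 y x)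
    (fun i hi => hpT y x i hi) (fun i => fun b => u (pxs y x i, b))
  rw [hpend, hp0] at h
  have hs : ∑ i ∈ range (dep y x), ((R (pγ y x i) *ᵥ fun b => u (tgt (pγ y x i), b)) - fun b => u (src (pγ y x i), b)) ⬝ᵥ
        ((R (pγ y x i) *ᵥ fun b => u (tgt (pγ y x i), b)) - fun b => u (src (pγ y x i), b)) =
      ∑ i ∈ range (dep y x), ((R (pγ y x i) *ᵥ fun b => u (pxs y x (i + 1), b)) - fun b => u (pxs y x i, b)) ⬝ᵥ
        ((R (pγ y x i) *ᵥ fun b => u (pxs y x (i + 1), b)) - fun b => u (pxs y x i, b)) :=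
    Finset.sum_congr rfl fun i hi => by rw [hpsrc y x i (mem_range.mp hi), hptgt y x i (mem_range.mp hi)]
  rw [hs]
  linarith

omit [DecidableEq o] in
/-- **`sum_blockVar_le_tree` — PART 47's `hΦ` FROM THE TREE COUNT** [our proof]: with `Φ(y) := 4·Σ_x q(y,x)·dep(y,x)·Σ_{i<dep(y,x)}|D_{pγ(y,x,i)}u|²`, the
`q·dep`-weighted tree multiplicity `≤ m_T`, in-degree `≤ d′`, the fine form bound `w_f·Σ_e|D_e u|² ≤ ⟨u,H_f u⟩` and the bookkeeping
`4·w_c·d′·m_T ≤ ϖ·w_f` (`0 ≤ w_c, d′, ϖ`): `w_c·Σ_{e′}Φ(tgt′e′) ≤ ϖ·⟨u, H_f u⟩`. -/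
theorem sum_blockVar_le_tree
    (hq : ∀ y x, 0 ≤ q y x) (hwc : 0 ≤ wc) (hd' : 0 ≤ d') (hϖ : 0 ≤ ϖ)
    (hHf : ∀ u : ν × o → ℝ, wf * ∑ e, ((R e *ᵥ fun b => u (tgt e, b)) - fun b => u (src e, b)) ⬝ᵥ
        ((R e *ᵥ fun b => u (tgt e, b)) - fun b => u (src e, b)) ≤ u ⬝ᵥ (Hf *ᵥ u))
    (hmultT : ∀ e, ∑ y, ∑ x, ∑ i ∈ range (dep y x), (if pγ y x i = e then q y x * dep y x else 0) ≤ mT)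
    (hdeg : ∀ y, ((Finset.univ.filter fun e' => tgt' e' = y).card : ℝ) ≤ d')
    (hwT : 4 * wc * d' * mT ≤ ϖ * wf) (u : ν × o → ℝ) :
    wc * ∑ e', 4 * ∑ x, q (tgt' e') x * (dep (tgt' e') x * ∑ i ∈ range (dep (tgt' e') x),
        ((R (pγ (tgt' e') x i) *ᵥ fun b => u (tgt (pγ (tgt' e') x i), b)) - fun b => u (src (pγ (tgt' e') x i), b)) ⬝ᵥ
          ((R (pγ (tgt' e') x i) *ᵥ fun b => u (tgt (pγ (tgt' e') x i), b)) - fun b => u (src (pγ (tgt' e') x i), b))) ≤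
      ϖ * (u ⬝ᵥ (Hf *ᵥ u)) := by
  set F : β → ℝ := fun e => ((R e *ᵥ fun b => u (tgt e, b)) - fun b => u (src e, b)) ⬝ᵥ
    ((R e *ᵥ fun b => u (tgt e, b)) - fun b => u (src e, b)) with hF
  have hF0 : ∀ e, 0 ≤ F e := fun e => dotProduct_self_nonneg' _
  set Ψ : μ → ℝ := fun y => ∑ x, q y x * (dep y x * ∑ i ∈ range (dep y x), F (pγ y x i)) with hΨ
  have hΨ0 : ∀ y, 0 ≤ Ψ y := fun y => Finset.sum_nonneg fun x _ =>
    mul_nonneg (hq y x) (mul_nonneg (Nat.cast_nonneg _) (Finset.sum_nonneg fun i _ => hF0 _))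
  have hdeg' := sum_tgt_le_of_indegree tgt' hdeg Ψ hΨ0
  have hcount := sum_tree_le_of_multiplicity q dep pγ hmultT F hF0
  have hSF : 0 ≤ ∑ e, F e := Finset.sum_nonneg fun e _ => hF0 e
  have e1 : wc * ∑ e', 4 * Ψ (tgt' e') = 4 * wc * ∑ e', Ψ (tgt' e') := by rw [← Finset.mul_sum]; ring
  change wc * ∑ e', 4 * Ψ (tgt' e') ≤ ϖ * (u ⬝ᵥ (Hf *ᵥ u))
  rw [e1]
  calc 4 * wc * ∑ e', Ψ (tgt' e') ≤ 4 * wc * (d' * ∑ y, Ψ y) := mul_le_mul_of_nonneg_left hdeg' (by positivity)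
    _ ≤ 4 * wc * (d' * (mT * ∑ e, F e)) := mul_le_mul_of_nonneg_left (mul_le_mul_of_nonneg_left hcount hd') (by positivity)
    _ = (4 * wc * d' * mT) * ∑ e, F e := by ring
    _ ≤ (ϖ * wf) * ∑ e, F e := mul_le_mul_of_nonneg_right hwT hSF
    _ = ϖ * (wf * ∑ e, F e) := by ring
    _ ≤ ϖ * (u ⬝ᵥ (Hf *ᵥ u)) := mul_le_mul_of_nonneg_left (hHf u) hϖ

end Tree

/-! ## §3 THE END with the Poincaré datum discharged -/

section End

variable {o μ ν β β' : Type*} [Fintype o] [DecidableEq o] [Fintype μ] [DecidableEq μ] [Fintype ν] [Fintype β] [DecidableEq β] [Fintype β']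
variable {q : μ → ν → ℝ} {W : μ → ν → Matrix o o ℝ} {Q : Matrix (μ × o) (ν × o) ℝ}
variable {src tgt : β → ν} {R : β → Matrix o o ℝ} {src' tgt' : β' → μ} {R' : β' → Matrix o o ℝ}
variable {Hf : Matrix (ν × o) (ν × o) ℝ} {Hc : Matrix (μ × o) (μ × o) ℝ} {wf wc : ℝ}
variable {σ : β' → ν ≃ ν} {ℓ : ℕ} {xs : β' → ν → ℕ → ν} {γ : β' → ν → ℕ → β} {T : β' → ν → ℕ → Matrix o o ℝ} {m : ℝ}
variable {N : β' → ν → Matrix o o ℝ} {κ κ₂ : ℝ}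
variable {root : μ → ν} {dep : μ → ν → ℕ} {pxs : μ → ν → ℕ → ν} {pγ : μ → ν → ℕ → β} {pT : μ → ν → ℕ → Matrix o o ℝ}
variable {mT ϖ d' : ℝ}

/-- **`covJensen_meanZero_tree` — THE CONSISTENT-PAIR COVARIANT JENSEN INEQUALITY WITH THE POINCARÉ DATUM DISCHARGED** [our proof]: PART 47's
`covJensen_meanZero` with `hP` ∕ `hΦ` supplied by `blockVar_le_tree` ∕ `sum_blockVar_le_tree` (block transporters = root transporter × tree path
transports; `Σ_x q(y,x) = 1`; tree multiplicity `m_T`; `4·w_c·d′·m_T ≤ ϖ·w_f`).  For all `t, r > 0`: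
`⟨Qu, H_cQu⟩ ≤ (1 + t + (1+t⁻¹)(1+r)ϖκ²)·⟨u, H_f u⟩ + (1+t⁻¹)(1+r⁻¹)κ₂²·w_c·d′·⟨Qu, Qu⟩`. -/
theorem covJensen_meanZero_tree
    (hq : ∀ y x, 0 ≤ q y x) (hq1 : ∀ y, ∑ x, q y x = 1) (hW : ∀ y x, (W y x)ᵀ * W y x = 1) (hR : ∀ e, (R e)ᵀ * R e = 1)
    (hR' : ∀ e', (R' e')ᵀ * R' e' = 1)
    (hQ : ∀ (u : ν × o → ℝ) (y : μ), (fun a => (Q *ᵥ u) (y, a)) = ∑ x, q y x • (W y x *ᵥ fun b => u (x, b)))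
    (hwc : 0 ≤ wc) (hd' : 0 ≤ d') (hϖ : 0 ≤ ϖ)
    (hHc : ∀ v : μ × o → ℝ, v ⬝ᵥ (Hc *ᵥ v) ≤
      wc * ∑ e', ((R' e' *ᵥ fun a => v (tgt' e', a)) - fun a => v (src' e', a)) ⬝ᵥ
        ((R' e' *ᵥ fun a => v (tgt' e', a)) - fun a => v (src' e', a)))
    (hHf : ∀ u : ν × o → ℝ, wf * ∑ e, ((R e *ᵥ fun b => u (tgt e, b)) - fun b => u (src e, b)) ⬝ᵥ
        ((R e *ᵥ fun b => u (tgt e, b)) - fun b => u (src e, b)) ≤ u ⬝ᵥ (Hf *ᵥ u))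
    (hσq : ∀ e' x, q (tgt' e') (σ e' x) = q (src' e') x)
    (hx0 : ∀ e' x, xs e' x 0 = x) (hxℓ : ∀ e' x, xs e' x ℓ = σ e' x)
    (hsrc : ∀ e' x i, i < ℓ → src (γ e' x i) = xs e' x i) (htgt : ∀ e' x i, i < ℓ → tgt (γ e' x i) = xs e' x (i + 1))
    (hT0 : ∀ e' x, T e' x 0 = 1) (hT : ∀ e' x i, i < ℓ → T e' x (i + 1) = T e' x i * R (γ e' x i))
    (hmult : ∀ e, ∑ e', ∑ x, ∑ i ∈ range ℓ, (if γ e' x i = e then q (src' e') x else 0) ≤ m)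
    (hw : wc * ℓ * m ≤ wf)
    (hNdef : ∀ e' x, N e' x = 1 - W (src' e') x * T e' x ℓ * (W (tgt' e') (σ e' x))ᵀ * (R' e')ᵀ)
    (hN : ∀ e' x (w : o → ℝ), (N e' x *ᵥ w) ⬝ᵥ (N e' x *ᵥ w) ≤ κ ^ 2 * (w ⬝ᵥ w))
    (hM : ∀ e' (w : o → ℝ), ((∑ x, q (src' e') x • N e' x) *ᵥ w) ⬝ᵥ ((∑ x, q (src' e') x • N e' x) *ᵥ w) ≤ κ₂ ^ 2 * (w ⬝ᵥ w))
    (hp0 : ∀ y x, pxs y x 0 = root y) (hpend : ∀ y x, pxs y x (dep y x) = x)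
    (hpsrc : ∀ y x i, i < dep y x → src (pγ y x i) = pxs y x i) (hptgt : ∀ y x i, i < dep y x → tgt (pγ y x i) = pxs y x (i + 1))
    (hpT0 : ∀ y x, pT y x 0 = 1) (hpT : ∀ y x i, i < dep y x → pT y x (i + 1) = pT y x i * R (pγ y x i))
    (hWtree : ∀ y x, W y x = W y (root y) * pT y x (dep y x))
    (hmultT : ∀ e, ∑ y, ∑ x, ∑ i ∈ range (dep y x), (if pγ y x i = e then q y x * dep y x else 0) ≤ mT)
    (hdeg : ∀ y, ((Finset.univ.filter fun e' => tgt' e' = y).card : ℝ) ≤ d')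
    (hwT : 4 * wc * d' * mT ≤ ϖ * wf)
    (u : ν × o → ℝ) {t r : ℝ} (ht : 0 < t) (hr : 0 < r) :
    (Q *ᵥ u) ⬝ᵥ (Hc *ᵥ (Q *ᵥ u)) ≤
      (1 + t + (1 + t⁻¹) * (1 + r) * ϖ * κ ^ 2) * (u ⬝ᵥ (Hf *ᵥ u)) +
        (1 + t⁻¹) * (1 + r⁻¹) * κ₂ ^ 2 * wc * d' * ((Q *ᵥ u) ⬝ᵥ (Q *ᵥ u)) :=
  covJensen_meanZero hq (fun y => (hq1 y).le) hW hR hR' hQ hwc hHc hHf hσq hx0 hxℓ hsrc htgt hT0 hT hmult hw hNdef hN hM u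
    (Φ := fun u y => 4 * ∑ x, q y x * (dep y x * ∑ i ∈ range (dep y x),
        ((R (pγ y x i) *ᵥ fun b => u (tgt (pγ y x i), b)) - fun b => u (src (pγ y x i), b)) ⬝ᵥ
          ((R (pγ y x i) *ᵥ fun b => u (tgt (pγ y x i), b)) - fun b => u (src (pγ y x i), b))))
    (fun y => blockVar_le_tree hq hq1 (fun y => hW y (root y)) hR hQ hp0 hpend hpsrc hptgt hpT0 hpT hWtree u y)
    (sum_blockVar_le_tree hq hwc hd' hϖ hHf hmultT hdeg hwT u) hdeg ht hr

end End

end Summit.QuantumFields.BalabanUV.Beta.GAN24.DerivativeRateTransferJensenMeanZeroTree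

end
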